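import Summits.ValiantsHypothesis.ValiantsHypothesis.Theorems.TwoProducts.RankTwoJacobianAxial
import Mathlib.RingTheory.MvPolynomial.EulerIdentity

/-!
# Rank-three WRONSKIAN RULE (rung 3-LIN of the table-rank side ladder): `Ω(w)·(∂ᵢP)(w) = L_m(…)` — Euler + two chain rules eliminate to a product

`Poly3`, the toric Wronskian `omega`, the first-order operator `ell`, `jacDer_map_aeval3` (the `Fin 3` chain rule for `jacDer`), ★ `chainRule3`, `euler_aeval`, ★ `wronskianRule`
(+ cyclic `wronskianRule₀`, `wronskianRule₁`), `support_omega_subset`, `card_support_omega_le`.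

PORT (val-lit-p3 g18) under val-idea-crit-8 g4's VERDICT #44 LICENCE (R3a/R3b; «import landed `Theorems/TwoProducts/RankTwoJacobian.lean` vocabulary — never
re-declare `Poly2/emb/nv/theta/jac/wt/IsEdgeDir/idet/jacDer/derivation_map_aeval`») of val-idea-35 g10's crux workfile
`Cruxes/TwoProducts/RankThreeWronskian_val_idea_35_g10.lean` (tree bytes, rung 3-LIN of the SIDE ladder «table-rank-ladder»; VERDICT #44 ACCEPTED: kernel ★ rule +
top coefficient + transfer + dependent case) — bodies VERBATIM, namespace `…Cruxes.TwoProducts.ValIdea35g10` → `…Theorems.TwoProducts.RankTwoJacobian` (the landed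
rank-two vocabulary is reused BY NAME; `jac_self`, `jacDer_apply`, `theta_*`, `support_jac_subset`, `wt_add`, `coeff_mul_of_unique`, `idet_zero_right`, `jac_eq_sum`,
`coeff_jac` are the ✓ `…RankTwoJacobian{,Ostrowski,Axial}` theorems, not restated).  NOT ported (fact debt per the licence): `RankThreeLinearLaw` /
`RankThreeExplicitBound` / `TwoProductsLinRankThree` / `PortPlan3` and their bridges — they wait for `PortPlan3.1` in the kernel (idea-35 g10's `TowerKernel3`).
HONEST LABEL: helper lemmas of rung 3-LIN; the rank-three law is PAPER (count) until `PortPlan3.1` lands; 0 distance on `ResidualLawV25`; 5906 / PCB OPEN;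
VP ≠ VNP is NOT proved.  `--supports stmt-ValiantsHypothesis-5906 --as helper`.  Credit: val-idea-35 g10.  No instances, no notation, no named facts. [folklore]
-/

noncomputable section
set_option linter.dupNamespace false

namespace Summit.ValiantsHypothesis.ValiantsHypothesis.Theorems.TwoProducts.RankTwoJacobian

open scoped BigOperators Pointwise
open MvPolynomial

/-- Trivariate complex polynomials (the pencil's parameter ring). [folklore] -/
abbrev Poly3 := MvPolynomial (Fin 3) ℂ

/-- TORIC WRONSKIAN of three bivariate polynomials: `Ω(w) = det [w ; θ₀ w ; θ₁ w]`
`= w₀ J(w₁,w₂) + w₁ J(w₂,w₀) + w₂ J(w₀,w₁)`.  Trilinear, alternating, `Ω(Bw) = det B · Ω(w)`,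
`supp Ω ⊆ S₀+S₁+S₂` (`≤ t³` monomials); `Ω = 0` iff `w₁/w₀, w₂/w₀` are algebraically dependent. -/
def omega (w : Fin 3 → Poly2) : Poly2 :=
  w 0 * jac (w 1) (w 2) + w 1 * jac (w 2) (w 0) + w 2 * jac (w 0) (w 1)

/-- The first-order operator `L_k^{u,v} F = v·J(F,u) − u·J(F,v) + k·J(u,v)·F` (for `F = Q(w)` with `Q` homogeneous of
degree `k`, `L_k^{w₀,w₁} F = Ω(w)·(∂₂Q)(w)` — `wronskianRule`). -/
def ell (k : ℕ) (u v F : Poly2) : Poly2 := v * jac F u - u * jac F v + (k : ℂ) • (jac u v * F)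

/-- Chain rule for `jacDer G` along TRIVARIATE polynomial maps (the `Fin 3` analogue of ✓ `jacDer_map_aeval`; specialisation of the out-of-cone
✓ `Literature.ModelTheory.PseudofiniteFields.Derivation.map_mvPolynomial_aeval`, same induction). [folklore] -/
theorem jacDer_map_aeval3 (G : Poly2) (a : Fin 3 → Poly2) (p : Poly3) :
    jacDer G (aeval a p) = ∑ i, aeval a (pderiv i p) * jacDer G (a i) := by
  induction p using MvPolynomial.induction_on with
  | C r => simp
  | add p q hp hq =>
    simp only [map_add, hp, hq, add_mul, Finset.sum_add_distrib]
  | mul_X p s hp =>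
    have hX : ∀ i : Fin 3, aeval a (pderiv i (X s : Poly3)) = if s = i then (1 : Poly2) else 0 := by
      intro i
      rw [pderiv_X, Pi.single_apply]
      split_ifs <;> simp
    have hR : ∀ i, aeval a (pderiv i (p * X s)) * jacDer G (a i) =
        a s * (aeval a (pderiv i p) * jacDer G (a i)) + (if s = i then aeval a p * jacDer G (a i) else 0) := by
      intro i
      rw [Derivation.leibniz, map_add, smul_eq_mul, smul_eq_mul, map_mul, map_mul, aeval_X, hX,
        add_mul, add_comm, mul_assoc]
      congr 1
      split_ifs <;> simp
    rw [map_mul, aeval_X, Derivation.leibniz, hp]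
    simp_rw [hR, Finset.sum_add_distrib, Finset.sum_ite_eq, Finset.mem_univ, if_true, smul_eq_mul]
    rw [add_comm, Finset.mul_sum]

/-- THREE-variable chain rule for the biderivation `J`: `J(P(w), G) = Σᵢ (∂ᵢP)(w) · J(wᵢ, G)`. -/
theorem chainRule3 (P : Poly3) (w : Fin 3 → Poly2) (G : Poly2) :
    jac (aeval w P) G = ∑ i : Fin 3, aeval w (pderiv i P) * jac (w i) G := by
  have h := jacDer_map_aeval3 G w P
  rw [jacDer_apply] at h
  rw [h]
  simp only [Fin.sum_univ_three, jacDer_apply]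

/-- Euler's identity, evaluated at `w`: `Σᵢ wᵢ·(∂ᵢP)(w) = m·P(w)`. -/
theorem euler_aeval (P : Poly3) (m : ℕ) (hP : P.IsHomogeneous m) (w : Fin 3 → Poly2) :
    ∑ i : Fin 3, w i * aeval w (pderiv i P) = (m : ℂ) • aeval w P := by
  have h := congrArg (aeval w) hP.sum_X_mul_pderiv
  rw [map_sum, map_nsmul] at h
  simp_rw [map_mul, aeval_X] at h
  rw [h, Nat.cast_smul_eq_nsmul]

/-- **THE WRONSKIAN RULE in the kernel** (identity (I) of the memo): for `P` homogeneous of degree `m`,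
`Ω(w) · (∂₂P)(w) = w₁·J(P(w),w₀) − w₀·J(P(w),w₁) + m·J(w₀,w₁)·P(w)`. -/
theorem wronskianRule (w : Fin 3 → Poly2) (P : Poly3) (m : ℕ) (hP : P.IsHomogeneous m) :
    omega w * aeval w (pderiv 2 P) = ell m (w 0) (w 1) (aeval w P) := by
  have hE := euler_aeval P m hP w
  have h0 := chainRule3 P w (w 0)
  have h1 := chainRule3 P w (w 1)
  simp only [Fin.sum_univ_three] at hE h0 h1
  rw [Algebra.smul_def] at hE
  unfold ell
  rw [h0, h1, Algebra.smul_def]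
  unfold omega jac
  linear_combination (theta 0 (w 0) * theta 1 (w 1) - theta 1 (w 0) * theta 0 (w 1)) * hE

/-- The cyclic companions (same proof): `Ω·(∂₀P)(w) = L_m^{w₁,w₂} P(w)` and `Ω·(∂₁P)(w) = L_m^{w₂,w₀} P(w)`. -/
theorem wronskianRule₀ (w : Fin 3 → Poly2) (P : Poly3) (m : ℕ) (hP : P.IsHomogeneous m) :
    omega w * aeval w (pderiv 0 P) = ell m (w 1) (w 2) (aeval w P) := by
  have hE := euler_aeval P m hP w
  have h1 := chainRule3 P w (w 1)
  have h2 := chainRule3 P w (w 2)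
  simp only [Fin.sum_univ_three] at hE h1 h2
  rw [Algebra.smul_def] at hE
  unfold ell
  rw [h1, h2, Algebra.smul_def]
  unfold omega jac
  linear_combination (theta 0 (w 1) * theta 1 (w 2) - theta 1 (w 1) * theta 0 (w 2)) * hE

/-- Cyclic companion of `wronskianRule`. [val-idea-35 g10] -/
theorem wronskianRule₁ (w : Fin 3 → Poly2) (P : Poly3) (m : ℕ) (hP : P.IsHomogeneous m) :
    omega w * aeval w (pderiv 1 P) = ell m (w 2) (w 0) (aeval w P) := by
  have hE := euler_aeval P m hP w
  have h2 := chainRule3 P w (w 2)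
  have h0 := chainRule3 P w (w 0)
  simp only [Fin.sum_univ_three] at hE h2 h0
  rw [Algebra.smul_def] at hE
  unfold ell
  rw [h2, h0, Algebra.smul_def]
  unfold omega jac
  linear_combination (theta 0 (w 2) * theta 1 (w 0) - theta 1 (w 2) * theta 0 (w 0)) * hE

/-- `supp Ω(w) ⊆ S₀ + S₁ + S₂`, hence `≤ t³` monomials. -/
theorem support_omega_subset (w : Fin 3 → Poly2) :
    (omega w).support ⊆ (w 0).support + (w 1).support + (w 2).support := by
  unfold omega
  refine (MvPolynomial.support_add).trans (Finset.union_subset ((MvPolynomial.support_add).trans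
    (Finset.union_subset ?_ ?_)) ?_)
  · refine (MvPolynomial.support_mul _ _).trans ?_
    refine (Finset.add_subset_add_left (support_jac_subset (w 1) (w 2))).trans ?_
    rw [← add_assoc]
  · refine (MvPolynomial.support_mul _ _).trans ?_
    refine (Finset.add_subset_add_left (support_jac_subset (w 2) (w 0))).trans ?_
    rw [← add_assoc, add_right_comm, add_comm ((w 1).support)]
  · refine (MvPolynomial.support_mul _ _).trans ?_
    refine (Finset.add_subset_add_left (support_jac_subset (w 0) (w 1))).trans ?_
    rw [← add_assoc, add_rotate]

/-- `Ω(w)` has `≤ t³` monomials when the `wᵢ` are `t`-sparse. [val-idea-35 g10] -/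
theorem card_support_omega_le (w : Fin 3 → Poly2) (t : ℕ) (hw : ∀ i, (w i).support.card ≤ t) :
    (omega w).support.card ≤ t ^ 3 := by
  calc (omega w).support.card ≤ ((w 0).support + (w 1).support + (w 2).support).card :=
        Finset.card_le_card (support_omega_subset w)
    _ ≤ ((w 0).support + (w 1).support).card * (w 2).support.card := Finset.card_add_le
    _ ≤ ((w 0).support.card * (w 1).support.card) * (w 2).support.card :=
        Nat.mul_le_mul_right _ Finset.card_add_le
    _ ≤ (t * t) * t := Nat.mul_le_mul (Nat.mul_le_mul (hw 0) (hw 1)) (hw 2)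
    _ = t ^ 3 := by ring

end Summit.ValiantsHypothesis.ValiantsHypothesis.Theorems.TwoProducts.RankTwoJacobian

end
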